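import Summits.CriticalPhenomena.PercolationContinuityZ3.Theorems.PercNearOneGluingNoHeavyLowerTailAntipodalR1TwoCutGraded
import Summits.CriticalPhenomena.PercolationContinuityZ3.Theorems.PercNearOneGluingNoHeavyLowerTailAntipodalR1TwoCutCutVertex
import HarnessLib

/-!
# ANTI₁ across a cut vertex, graded: blocks hanging away from the terminals

Support file for `stmt-CriticalPhenomena-4575` (memo `prim-gen-kcluster/KCLUSTER-gen73.md` §1.8 (A),
graded; conjecture ANTI₁-GRADED of `KCLUSTER-gen52.md` §3).  No definitions, no named facts, no sorries.
Vocabulary of `AntipodalR1` (gen 62); parts IV (loops) and VIII (graded 2-cut reduction) of gen 78.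

Loops are invisible to the coloured graphs (`SimpleGraph.fromEdgeSet` discards the diagonal), hence to
the grade (`colGraph_loops_eq`, `grade_loops_eq`), and to `L`, `R` (part IV).  So the two gadget
hypotheses of the graded 2-cut reduction with `u = v = h` reduce to the graded hypothesis for `G₁`
(`filter_lSet_loops_grade_eq`, `filter_rSet_loops_grade_eq`), which gives:

**Theorem** (`card_lSet_grade_le_of_cutVertex`): if `G = G₁ ∪ G₂` with every vertex met by edges of
both sides equal to `h`, and `a, b, c` met by edges of `G₂` only if equal to `h`, then ANTI₁-GRADED for
`G₁` implies ANTI₁-GRADED for `G` (level by level).  [this work]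
-/

namespace Summit.CriticalPhenomena.PercolationContinuityZ3.Theorems

namespace AntipodalR1

open Finset Relation SimpleGraph

variable {V ι₁ ι₂ κ : Type*}

section Loops

variable {ends₁ : ι₁ → Sym2 V} {h : V}

/-- Loops do not change the coloured graphs. [this work] -/
theorem colGraph_loops_eq (ω : ι₁ ⊕ κ → Bool) (col : Bool) :
    fromEdgeSet {s : Sym2 V | ∃ e, ω e = col ∧ Sum.elim ends₁ (fun _ : κ => s(h, h)) e = s} =
      fromEdgeSet {s : Sym2 V | ∃ i, ω (Sum.inl i) = col ∧ ends₁ i = s} := by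
  ext x y
  simp only [fromEdgeSet_adj, Set.mem_setOf_eq]
  constructor
  · rintro ⟨⟨e, he, hends⟩, hne⟩
    cases e with
    | inl i => exact ⟨⟨i, he, hends⟩, hne⟩
    | inr k =>
      have hends' : s(h, h) = s(x, y) := hends
      rcases Sym2.eq_iff.1 hends' with ⟨hx, hy⟩ | ⟨hy, hx⟩
      · exact (hne (hx.symm.trans hy)).elim
      · exact (hne (hx.symm.trans hy)).elim
  · rintro ⟨⟨i, hi, hends⟩, hne⟩
    exact ⟨⟨Sum.inl i, hi, hends⟩, hne⟩

/-- Loops do not change the grade. [this work] -/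
theorem grade_loops_eq (ω : ι₁ ⊕ κ → Bool) :
    (Nat.card (fromEdgeSet {s : Sym2 V | ∃ e, ω e = true ∧
        Sum.elim ends₁ (fun _ : κ => s(h, h)) e = s}).ConnectedComponent +
      Nat.card (fromEdgeSet {s : Sym2 V | ∃ e, ω e = false ∧
        Sum.elim ends₁ (fun _ : κ => s(h, h)) e = s}).ConnectedComponent) =
    (Nat.card (fromEdgeSet {s : Sym2 V | ∃ i, ω (Sum.inl i) = true ∧ ends₁ i = s}).ConnectedComponent +
      Nat.card (fromEdgeSet {s : Sym2 V | ∃ i, ω (Sum.inl i) = false ∧ ends₁ i = s}).ConnectedComponent) := by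
  rw [colGraph_loops_eq ω true, colGraph_loops_eq ω false]

variable {a b c : V} [Fintype ι₁] [DecidableEq ι₁] [Fintype κ] [DecidableEq κ]

open Classical in
/-- Every graded `L`-fibre of "`G₁` plus loops" is the graded `L(G₁)`. [this work] -/
theorem filter_lSet_loops_grade_eq (g : κ → Bool) (t : ℕ) :
    (univ.filter fun ω₁ : ι₁ → Bool =>
        Sum.elim ω₁ g ∈ lSet (Sum.elim ends₁ (fun _ : κ => s(h, h))) a b c ∧
        (Nat.card (fromEdgeSet {s : Sym2 V | ∃ e, Sum.elim ω₁ g e = true ∧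
          Sum.elim ends₁ (fun _ : κ => s(h, h)) e = s}).ConnectedComponent +
        Nat.card (fromEdgeSet {s : Sym2 V | ∃ e, Sum.elim ω₁ g e = false ∧
          Sum.elim ends₁ (fun _ : κ => s(h, h)) e = s}).ConnectedComponent) = t) =
      (univ.filter fun ω₁ : ι₁ → Bool => ω₁ ∈ lSet ends₁ a b c ∧
        (Nat.card (fromEdgeSet {s : Sym2 V | ∃ e, ω₁ e = true ∧ ends₁ e = s}).ConnectedComponent +
        Nat.card (fromEdgeSet {s : Sym2 V | ∃ e, ω₁ e = false ∧ ends₁ e = s}).ConnectedComponent) = t) := by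
  refine filter_congr fun ω₁ _ => ?_
  rw [mem_lSet_loops_iff, grade_loops_eq]
  simp only [Sum.elim_inl]

open Classical in
/-- Every graded `R`-fibre of "`G₁` plus loops" is the graded `R(G₁)`. [this work] -/
theorem filter_rSet_loops_grade_eq (g : κ → Bool) (t : ℕ) :
    (univ.filter fun ω₁ : ι₁ → Bool =>
        Sum.elim ω₁ g ∈ rSet (Sum.elim ends₁ (fun _ : κ => s(h, h))) a b c ∧
        (Nat.card (fromEdgeSet {s : Sym2 V | ∃ e, Sum.elim ω₁ g e = true ∧
          Sum.elim ends₁ (fun _ : κ => s(h, h)) e = s}).ConnectedComponent +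
        Nat.card (fromEdgeSet {s : Sym2 V | ∃ e, Sum.elim ω₁ g e = false ∧
          Sum.elim ends₁ (fun _ : κ => s(h, h)) e = s}).ConnectedComponent) = t) =
      (univ.filter fun ω₁ : ι₁ → Bool => ω₁ ∈ rSet ends₁ a b c ∧
        (Nat.card (fromEdgeSet {s : Sym2 V | ∃ e, ω₁ e = true ∧ ends₁ e = s}).ConnectedComponent +
        Nat.card (fromEdgeSet {s : Sym2 V | ∃ e, ω₁ e = false ∧ ends₁ e = s}).ConnectedComponent) = t) := by
  refine filter_congr fun ω₁ _ => ?_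
  rw [mem_rSet_loops_iff, grade_loops_eq]
  simp only [Sum.elim_inl]

end Loops

section CutVertex

variable [Fintype V] [Fintype ι₁] [DecidableEq ι₁] [Fintype ι₂] [DecidableEq ι₂]

open Classical in
/-- **The graded 1-sum reduction, terminals on one side** (memo `KCLUSTER-gen73` §1.8 (A), graded kernel
form).  Let `G = G₁ ∪ G₂` where every vertex met by edges of both sides is `h`, and the apex `a` and the
terminals `b, c` are met by edges of `G₂` only if equal to `h`.  Then ANTI₁-GRADED for `G₁` implies
ANTI₁-GRADED for `G`, at every level.  No hypothesis on `G₂`. [this work] -/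
theorem card_lSet_grade_le_of_cutVertex (ends₁ : ι₁ → Sym2 V) (ends₂ : ι₂ → Sym2 V)
    (h a b c : V)
    (hsep : ∀ w i, w ∈ ends₁ i → ∀ j, w ∈ ends₂ j → w = h)
    (ha : ∀ j, a ∈ ends₂ j → a = h) (hb : ∀ j, b ∈ ends₂ j → b = h)
    (hc : ∀ j, c ∈ ends₂ j → c = h)
    (h0 : ∀ t, (univ.filter fun ω₁ : ι₁ → Bool => ω₁ ∈ lSet ends₁ a b c ∧
        (Nat.card (fromEdgeSet {s : Sym2 V | ∃ e, ω₁ e = true ∧ ends₁ e = s}).ConnectedComponent +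
        Nat.card (fromEdgeSet {s : Sym2 V | ∃ e, ω₁ e = false ∧ ends₁ e = s}).ConnectedComponent) = t).card ≤
      (univ.filter fun ω₁ : ι₁ → Bool => ω₁ ∈ rSet ends₁ a b c ∧
        (Nat.card (fromEdgeSet {s : Sym2 V | ∃ e, ω₁ e = true ∧ ends₁ e = s}).ConnectedComponent +
        Nat.card (fromEdgeSet {s : Sym2 V | ∃ e, ω₁ e = false ∧ ends₁ e = s}).ConnectedComponent) = t).card)
    (t : ℕ) :
    (univ.filter fun x : ι₁ ⊕ ι₂ → Bool => x ∈ lSet (Sum.elim ends₁ ends₂) a b c ∧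
        (Nat.card (fromEdgeSet {s : Sym2 V | ∃ e, x e = true ∧
          Sum.elim ends₁ ends₂ e = s}).ConnectedComponent +
        Nat.card (fromEdgeSet {s : Sym2 V | ∃ e, x e = false ∧
          Sum.elim ends₁ ends₂ e = s}).ConnectedComponent) = t).card ≤
      (univ.filter fun x : ι₁ ⊕ ι₂ → Bool => x ∈ rSet (Sum.elim ends₁ ends₂) a b c ∧
        (Nat.card (fromEdgeSet {s : Sym2 V | ∃ e, x e = true ∧
          Sum.elim ends₁ ends₂ e = s}).ConnectedComponent +
        Nat.card (fromEdgeSet {s : Sym2 V | ∃ e, x e = false ∧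
          Sum.elim ends₁ ends₂ e = s}).ConnectedComponent) = t).card := by
  refine card_lSet_grade_le_of_twoCut ends₁ ends₂ h h a b c
    (fun w i hw j hj => Or.inl (hsep w i hw j hj)) (fun j hj => Or.inl (ha j hj))
    (fun j hj => Or.inl (hb j hj)) (fun j hj => Or.inl (hc j hj)) h0 (fun t' => ?_) (fun t' => ?_) t
  · rw [card_level_plusEdge_eq, card_level_plusEdge_eq, filter_lSet_loops_grade_eq,
      filter_lSet_loops_grade_eq, filter_rSet_loops_grade_eq, filter_rSet_loops_grade_eq]
    exact Nat.add_le_add (h0 t') (h0 t')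
  · rw [filter_lSet_loops_grade_eq, filter_rSet_loops_grade_eq]
    exact h0 t'

end CutVertex

end AntipodalR1

end Summit.CriticalPhenomena.PercolationContinuityZ3.Theorems
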